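import Summits.QuantumAdvantage.QuantumAdvantage.Theorems.CubicForrelationNearExactIsExactSixteenSplitCapacity
import Summits.QuantumAdvantage.QuantumAdvantage.Theorems.CubicForrelationNearExactIsExactSixteenTypeO

/-!
# Crux `CubicForrelation.NearExactIsExact` (stmt-QuantumAdvantage-14043) — n = 16, TWO-SIDED budget in the SPLIT case: the three boundary
  configurations (sA), (sB), (sC)

Certificate seat `b2b-cforr-cert` (gen 6).  HONEST FRAMING: a structural lemma about cubic Boolean pairs on 16 bits (finite slice `n = 16` of
the crux) — the first step of the two-sided exclusion of the boundary value `Φ = 31/32` when the level-6 parity is a non-constant affine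
function; NOT summit progress.

With `W_g = 64u`, `s = (−1)^f`, the two-sided budget is `Σ_x (u − 4s)² = 2²¹(1 − Φ)` (`st_budget6`).  ONE pointwise inequality (`sb_pt2`),
for every integer `v` and sign `s`:
`(v − 4s)² ≥ [v odd] + 4·[v ≡ 2 (4)] + 16·[v ≡ 0 (8)] + 8·[v ≡ ±1 (8)]`,
with the SAME digit sets `O, A, B, C` as the one-sided capacity analysis (`sx_sum_pt`).  In the split case `#O = 2¹⁵` and the Reed–Muller
bounds of `…SixteenSplitCapacity` (`A` degree `≤ 3`, `B` degree `≤ 5`, `C` degree `≤ 4`; residual excluded by `sx_residual_false`) give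
`#O + 4#A + 16#B + 8#C ≥ 2¹⁶`.  Hence (`sb_split_trichotomy`) `Φ ≥ 31/32` forces: `Φ = 31/32` exactly, POINTWISE equality in `sb_pt2`, and exactly
one of (sA) `#A = 2¹³, B = C = ∅`; (sB) `A = ∅, #B = 2¹¹, C = ∅`; (sC) `A = B = ∅, #C = 2¹²`.  The three configurations are excluded in the
companion files `…SixteenSplitA/B/C`.

References: J. Ax (1964) / R. J. McEliece (1972); MacWilliams–Sloane (1977) Ch. 13–15; S. Aaronson, A. Ambainis, SIAM J. Comput. 47 (2018)
§1.1.1.  Everything below is proved from Mathlib and the tree; axioms are the standard three.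
-/

set_option linter.dupNamespace false -- D-0017: single-problem summit ⇒ `QuantumAdvantage.QuantumAdvantage` by design

noncomputable section

namespace Summit.QuantumAdvantage.QuantumAdvantage.Theorems.CubicForrelation.NearExactIsExact

open Finset
open Literature.Computability.QuantumComplexity
open Literature.Computability.QuantumComplexity.DerivativeWalsh (W)

/-! ### The two-sided pointwise inequality -/

/-- **The two-sided pointwise inequality.** For every integer `v` and `s = ±1`:
`[v odd] + 4·[¬d₀ ∧ d₁] + 16·[¬d₀ ∧ ¬d₁ ∧ ¬d₂] + 8·[d₀ ∧ (d₁ ↔ d₂)] ≤ (v − 4s)²` in the Euclidean binary digits of `v`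
(the residual `v − 4s` is `≡ v (mod 4)` and `≡ v + 4 (mod 8)`). [this work] -/
theorem sb_pt2 (v s : ℤ) (hs : s = 1 ∨ s = -1) :
    (if Odd v then 1 else 0) + 4 * (if ¬ Odd v ∧ Odd (v / 2) then 1 else 0)
      + 16 * (if ¬ Odd v ∧ ¬ Odd (v / 2) ∧ ¬ Odd (v / 2 / 2) then 1 else 0)
      + 8 * (if Odd v ∧ (Odd (v / 2) ↔ Odd (v / 2 / 2)) then 1 else 0) ≤ (v - 4 * s) ^ 2 := by
  rcases le_or_gt 9 |v| with h9 | h9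
  · have hbig : (25 : ℤ) ≤ (v - 4 * s) ^ 2 := by
      have h5 : v - 4 * s ≤ -5 ∨ 5 ≤ v - 4 * s := by
        rcases hs with rfl | rfl
        · rcases le_or_gt 0 v with hv | hv
          · rw [abs_of_nonneg hv] at h9; omega
          · rw [abs_of_neg hv] at h9; omega
        · rcases le_or_gt 0 v with hv | hv
          · rw [abs_of_nonneg hv] at h9; omega
          · rw [abs_of_neg hv] at h9; omega
      exact tp_sq_ge (k := 5) (by norm_num) h5
    have hconst : (if Odd v then 1 else 0) + 4 * (if ¬ Odd v ∧ Odd (v / 2) then 1 else 0)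
        + 16 * (if ¬ Odd v ∧ ¬ Odd (v / 2) ∧ ¬ Odd (v / 2 / 2) then 1 else 0)
        + 8 * (if Odd v ∧ (Odd (v / 2) ↔ Odd (v / 2 / 2)) then 1 else 0) ≤ (25 : ℤ) := by
      split_ifs <;> (try simp only [Int.odd_iff] at *) <;> omega
    linarith
  · have h1 : -8 ≤ v := by have := (abs_lt.1 h9).1; omega
    have h2 : v ≤ 8 := by have := (abs_lt.1 h9).2; omega
    rcases hs with rfl | rfl <;> interval_cases v <;> norm_num [Int.odd_iff]

section Split

variable (f g : (Fin (8 + 8) → Bool) → Bool) (u : (Fin (8 + 8) → Bool) → ℤ)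

/-- Summing `sb_pt2`: `#O + 4#A + 16#B + 8#C ≤ Σ_x (u − 4s)²` for the four digit sets. [this work] -/
theorem sb_sum_pt2 :
    (#(univ.filter fun x : Fin (8 + 8) → Bool => Odd (u x)) : ℤ)
      + 4 * (#(univ.filter fun x : Fin (8 + 8) → Bool => ¬ Odd (u x) ∧ Odd (u x / 2)) : ℤ)
      + 16 * (#(univ.filter fun x : Fin (8 + 8) → Bool => ¬ Odd (u x) ∧ ¬ Odd (u x / 2) ∧ ¬ Odd (u x / 2 / 2)) : ℤ)
      + 8 * (#(univ.filter fun x : Fin (8 + 8) → Bool => Odd (u x) ∧ (Odd (u x / 2) ↔ Odd (u x / 2 / 2))) : ℤ)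
      ≤ ∑ x, (u x - 4 * sZ (f x)) ^ 2 := by
  have h := sum_le_sum fun x (_ : x ∈ (univ : Finset (Fin (8 + 8) → Bool))) => sb_pt2 (u x) (sZ (f x)) (tp_sZ_cases (f x))
  simp only [sum_add_distrib, ← mul_sum, sum_boole] at h
  push_cast at h ⊢
  linarith

/-- **The Reed–Muller count in the split case** (extracted from the one-sided capacity analysis): if the level-6 parity takes both values,
then `4#A + 16#B + 8#C ≥ 2¹⁵`, and more precisely `A ≠ ∅ ⇒ #A ≥ 2¹³`, `A = ∅ ∧ B ≠ ∅ ⇒ #B ≥ 2¹¹`, `A = B = ∅ ∧ C ≠ ∅ ⇒ #C ≥ 2¹²`,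
`A = B = C = ∅` impossible. [this work] -/
theorem sb_rm_counts (hg : IsDegLeFun 3 g) (hu : ∀ x, W (fun y => signOf (g y)) x = (2 : ℝ) ^ 6 * (u x : ℝ))
    (hodd : ∃ x, Odd (u x)) (heven : ∃ x, ¬ Odd (u x)) :
    ((∃ x, ¬ Odd (u x) ∧ Odd (u x / 2)) → 2 ^ 13 ≤ #(univ.filter fun x : Fin (8 + 8) → Bool => ¬ Odd (u x) ∧ Odd (u x / 2))) ∧
    ((∀ x, ¬ Odd (u x) → ¬ Odd (u x / 2)) → (∃ x, ¬ Odd (u x) ∧ ¬ Odd (u x / 2 / 2)) →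
      2 ^ 11 ≤ #(univ.filter fun x : Fin (8 + 8) → Bool => ¬ Odd (u x) ∧ ¬ Odd (u x / 2) ∧ ¬ Odd (u x / 2 / 2))) ∧
    ((∀ x, ¬ Odd (u x) → ¬ Odd (u x / 2) ∧ Odd (u x / 2 / 2)) → (∃ x, Odd (u x) ∧ (Odd (u x / 2) ↔ Odd (u x / 2 / 2))) →
      2 ^ 12 ≤ #(univ.filter fun x : Fin (8 + 8) → Bool => Odd (u x) ∧ (Odd (u x / 2) ↔ Odd (u x / 2 / 2)))) ∧
    ((∀ x, ¬ Odd (u x) → ¬ Odd (u x / 2) ∧ Odd (u x / 2 / 2)) →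
      (∀ x, Odd (u x) → ¬ (Odd (u x / 2) ↔ Odd (u x / 2 / 2))) → False) := by
  have hd0 : IsDegLeFun 1 (fun x => decide (Odd (u x))) := sx_digitZero g u hg hu
  have hd1 : IsDegLeFun 2 (fun x => decide (Odd (u x / 2))) := sx_digitOne g u hg hu
  have hd2 : IsDegLeFun 4 (fun x => decide (Odd (u x / 2 / 2))) := sx_digitTwo g u hg hu
  refine ⟨fun hxA => ?_, fun hA hxB => ?_, fun hAB hxC => ?_, fun hAB hC => ?_⟩
  · have hdeg : IsDegLeFun 3 (fun x => (decide (Odd (u x)) ^^ true) && decide (Odd (u x / 2))) :=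
      bb_deg_and (tb_isDegLeFun_xor_const hd0 true) hd1 (by norm_num)
    have hset : (univ.filter fun x : Fin (8 + 8) → Bool => ((decide (Odd (u x)) ^^ true) && decide (Odd (u x / 2))) = true) =
        univ.filter fun x : Fin (8 + 8) → Bool => ¬ Odd (u x) ∧ Odd (u x / 2) := filter_congr fun x _ => by simp
    obtain ⟨x₀, hx₀, hx₀'⟩ := hxA
    have hrm := bb_rmWeight_holds (8 + 8) 3 _ hdeg ⟨x₀, by simp [hx₀, hx₀']⟩
    rw [hset] at hrm
    have h2 : (2 : ℕ) ^ (8 + 8) = 2 ^ 3 * 2 ^ 13 := by norm_num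
    rw [h2] at hrm
    exact Nat.le_of_mul_le_mul_left hrm (by positivity)
  · have hdeg : IsDegLeFun 5 (fun x => (decide (Odd (u x)) ^^ true) && (decide (Odd (u x / 2 / 2)) ^^ true)) :=
      bb_deg_and (tb_isDegLeFun_xor_const hd0 true) (tb_isDegLeFun_xor_const hd2 true) (by norm_num)
    have hset : (univ.filter fun x : Fin (8 + 8) → Bool =>
        ((decide (Odd (u x)) ^^ true) && (decide (Odd (u x / 2 / 2)) ^^ true)) = true) =
        univ.filter fun x : Fin (8 + 8) → Bool => ¬ Odd (u x) ∧ ¬ Odd (u x / 2) ∧ ¬ Odd (u x / 2 / 2) := by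
      apply filter_congr
      intro x _
      simp only [Bool.xor_true, Bool.and_eq_true, Bool.not_eq_true', decide_eq_false_iff_not]
      exact ⟨fun h => ⟨h.1, hA x h.1, h.2⟩, fun h => ⟨h.1, h.2.2⟩⟩
    obtain ⟨x₀, hx₀, hx₀'⟩ := hxB
    have hrm := bb_rmWeight_holds (8 + 8) 5 _ hdeg ⟨x₀, by simp [hx₀, hx₀']⟩
    rw [hset] at hrm
    have h2 : (2 : ℕ) ^ (8 + 8) = 2 ^ 5 * 2 ^ 11 := by norm_num
    rw [h2] at hrm
    exact Nat.le_of_mul_le_mul_left hrm (by positivity)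
  · have hdeg : IsDegLeFun 4 (fun x => (decide (Odd (u x / 2)) ^^ decide (Odd (u x / 2 / 2))) ^^ true) :=
      tb_isDegLeFun_xor_const (bb_isDegLeFun_bxor (hd1.mono (by norm_num)) hd2) true
    have hset : (univ.filter fun x : Fin (8 + 8) → Bool =>
        ((decide (Odd (u x / 2)) ^^ decide (Odd (u x / 2 / 2))) ^^ true) = true) =
        univ.filter fun x : Fin (8 + 8) → Bool => Odd (u x) ∧ (Odd (u x / 2) ↔ Odd (u x / 2 / 2)) := by
      apply filter_congr
      intro x _
      by_cases h0 : Odd (u x)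
      · by_cases h1 : Odd (u x / 2) <;> by_cases h2 : Odd (u x / 2 / 2) <;> simp [h0, h1, h2]
      · have h12 := hAB x h0
        simp [h0, h12.1, h12.2]
    obtain ⟨x₀, hx₀, hx₀'⟩ := hxC
    have hmem : ((decide (Odd (u x₀ / 2)) ^^ decide (Odd (u x₀ / 2 / 2))) ^^ true) = true := by
      by_cases h1 : Odd (u x₀ / 2)
      · have h2 : Odd (u x₀ / 2 / 2) := hx₀'.1 h1
        simp [h1, h2]
      · have h2 : ¬ Odd (u x₀ / 2 / 2) := fun h => h1 (hx₀'.2 h)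
        simp [h1, h2]
    have hrm := bb_rmWeight_holds (8 + 8) 4 _ hdeg ⟨x₀, hmem⟩
    rw [hset] at hrm
    have h2 : (2 : ℕ) ^ (8 + 8) = 2 ^ 4 * 2 ^ 12 := by norm_num
    rw [h2] at hrm
    exact Nat.le_of_mul_le_mul_left hrm (by positivity)
  · exact sx_residual_false g u hg hu hodd heven hAB fun x hx => by have := hC x hx; tauto

/-- **The split trichotomy at the boundary.**  For cubic `f, g : 𝔽₂¹⁶ → 𝔽₂` with `W_g = 64u`, the level-6 parity `[u odd]` non-constant and
`Φ(f,g) ≥ 31/32`: the two-sided budget is spent EXACTLY — `Φ = 31/32`, the pointwise inequality `sb_pt2` is an equality at every point — and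
exactly one of (sA) `#A = 2¹³, B = C = ∅`, (sB) `A = ∅, #B = 2¹¹, C = ∅`, (sC) `A = B = ∅, #C = 2¹²` holds. [this work] -/
theorem sb_split_trichotomy (hg : IsDegLeFun 3 g) (hu : ∀ x, W (fun y => signOf (g y)) x = (2 : ℝ) ^ 6 * (u x : ℝ))
    (hodd : ∃ x, Odd (u x)) (heven : ∃ x, ¬ Odd (u x)) (hΦ : (31 / 32 : ℝ) ≤ forrelation f g) :
    forrelation f g = 31 / 32 ∧
    (∀ x, (u x - 4 * sZ (f x)) ^ 2 = (if Odd (u x) then 1 else 0) + 4 * (if ¬ Odd (u x) ∧ Odd (u x / 2) then 1 else 0)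
      + 16 * (if ¬ Odd (u x) ∧ ¬ Odd (u x / 2) ∧ ¬ Odd (u x / 2 / 2) then 1 else 0)
      + 8 * (if Odd (u x) ∧ (Odd (u x / 2) ↔ Odd (u x / 2 / 2)) then 1 else 0)) ∧
    ((#(univ.filter fun x : Fin (8 + 8) → Bool => ¬ Odd (u x) ∧ Odd (u x / 2)) = 2 ^ 13 ∧
        #(univ.filter fun x : Fin (8 + 8) → Bool => ¬ Odd (u x) ∧ ¬ Odd (u x / 2) ∧ ¬ Odd (u x / 2 / 2)) = 0 ∧
        #(univ.filter fun x : Fin (8 + 8) → Bool => Odd (u x) ∧ (Odd (u x / 2) ↔ Odd (u x / 2 / 2))) = 0) ∨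
      (#(univ.filter fun x : Fin (8 + 8) → Bool => ¬ Odd (u x) ∧ Odd (u x / 2)) = 0 ∧
        #(univ.filter fun x : Fin (8 + 8) → Bool => ¬ Odd (u x) ∧ ¬ Odd (u x / 2) ∧ ¬ Odd (u x / 2 / 2)) = 2 ^ 11 ∧
        #(univ.filter fun x : Fin (8 + 8) → Bool => Odd (u x) ∧ (Odd (u x / 2) ↔ Odd (u x / 2 / 2))) = 0) ∨
      (#(univ.filter fun x : Fin (8 + 8) → Bool => ¬ Odd (u x) ∧ Odd (u x / 2)) = 0 ∧
        #(univ.filter fun x : Fin (8 + 8) → Bool => ¬ Odd (u x) ∧ ¬ Odd (u x / 2) ∧ ¬ Odd (u x / 2 / 2)) = 0 ∧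
        #(univ.filter fun x : Fin (8 + 8) → Bool => Odd (u x) ∧ (Odd (u x / 2) ↔ Odd (u x / 2 / 2))) = 2 ^ 12)) := by
  classical
  set O := univ.filter fun x : Fin (8 + 8) → Bool => Odd (u x) with hO
  set A := univ.filter fun x : Fin (8 + 8) → Bool => ¬ Odd (u x) ∧ Odd (u x / 2) with hA
  set B := univ.filter fun x : Fin (8 + 8) → Bool => ¬ Odd (u x) ∧ ¬ Odd (u x / 2) ∧ ¬ Odd (u x / 2 / 2) with hB
  set C := univ.filter fun x : Fin (8 + 8) → Bool => Odd (u x) ∧ (Odd (u x / 2) ↔ Odd (u x / 2 / 2)) with hC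
  have hO15 : #O = 2 ^ 15 := sx_card_odd_of_split g u hg hu hodd heven
  obtain ⟨cA, cB, cC, cR⟩ := sb_rm_counts g u hg hu hodd heven
  -- budget `T ≤ 2¹⁶`
  have hbud := st_budget6 f g u hu
  have hT : (∑ x, (u x - 4 * sZ (f x)) ^ 2 : ℤ) ≤ 2 ^ 16 := by
    have h' : ((∑ x, (u x - 4 * sZ (f x)) ^ 2 : ℤ) : ℝ) ≤ 2 ^ 16 := by rw [hbud]; nlinarith
    exact_mod_cast h'
  have hsum := sb_sum_pt2 f u
  -- the Reed–Muller count `#O + 4#A + 16#B + 8#C ≥ 2¹⁶`, with the case split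
  have hA0 : (0 : ℤ) ≤ #A := by positivity
  have hB0 : (0 : ℤ) ≤ #B := by positivity
  have hC0 : (0 : ℤ) ≤ #C := by positivity
  have hmemA : ∀ x, x ∈ A ↔ ¬ Odd (u x) ∧ Odd (u x / 2) := fun x => by simp [hA]
  have hmemB : ∀ x, x ∈ B ↔ ¬ Odd (u x) ∧ ¬ Odd (u x / 2) ∧ ¬ Odd (u x / 2 / 2) := fun x => by simp [hB]
  have hmemC : ∀ x, x ∈ C ↔ Odd (u x) ∧ (Odd (u x / 2) ↔ Odd (u x / 2 / 2)) := fun x => by simp [hC]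
  have hcases : ((#A : ℤ) = 2 ^ 13 ∧ (#B : ℤ) = 0 ∧ (#C : ℤ) = 0) ∨ ((#A : ℤ) = 0 ∧ (#B : ℤ) = 2 ^ 11 ∧ (#C : ℤ) = 0) ∨
      ((#A : ℤ) = 0 ∧ (#B : ℤ) = 0 ∧ (#C : ℤ) = 2 ^ 12) := by
    have htot : (#O : ℤ) + 4 * #A + 16 * #B + 8 * #C ≤ 2 ^ 16 := le_trans hsum hT
    rw [hO15] at htot
    push_cast at htot
    by_cases hxA : ∃ x, ¬ Odd (u x) ∧ Odd (u x / 2)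
    · have h13 : (2 : ℤ) ^ 13 ≤ #A := by exact_mod_cast cA hxA
      left; refine ⟨by linarith, by linarith, by linarith⟩
    · push Not at hxA
      have hAe : (#A : ℤ) = 0 := by
        have : A = ∅ := filter_eq_empty_iff.2 fun x _ h => hxA x h.1 h.2
        rw [this]; rfl
      by_cases hxB : ∃ x, ¬ Odd (u x) ∧ ¬ Odd (u x / 2 / 2)
      · have h11 : (2 : ℤ) ^ 11 ≤ #B := by exact_mod_cast cB hxA hxB
        right; left; refine ⟨hAe, by linarith, by linarith⟩
      · push Not at hxB
        have hBe : (#B : ℤ) = 0 := by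
          have : B = ∅ := filter_eq_empty_iff.2 fun x _ h => h.2.2 (hxB x h.1)
          rw [this]; rfl
        have hH : ∀ x, ¬ Odd (u x) → ¬ Odd (u x / 2) ∧ Odd (u x / 2 / 2) := fun x h => ⟨hxA x h, hxB x h⟩
        by_cases hxC : ∃ x, Odd (u x) ∧ (Odd (u x / 2) ↔ Odd (u x / 2 / 2))
        · have h12 : (2 : ℤ) ^ 12 ≤ #C := by exact_mod_cast cC hH hxC
          right; right; refine ⟨hAe, hBe, by linarith⟩
        · push Not at hxC
          exact absurd (cR hH fun x hx h => by have := hxC x hx; tauto) id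
  have htot16 : (2 : ℤ) ^ 16 ≤ (#O : ℤ) + 4 * #A + 16 * #B + 8 * #C := by
    rw [hO15]; push_cast; rcases hcases with ⟨h1, h2, h3⟩ | ⟨h1, h2, h3⟩ | ⟨h1, h2, h3⟩ <;> rw [h1, h2, h3] <;> norm_num
  -- hence everything is tight
  have hTeq : (∑ x, (u x - 4 * sZ (f x)) ^ 2 : ℤ) = 2 ^ 16 := le_antisymm hT (le_trans htot16 hsum)
  have hΦeq : forrelation f g = 31 / 32 := by
    have h : ((∑ x, (u x - 4 * sZ (f x)) ^ 2 : ℤ) : ℝ) = 2 ^ 16 := by exact_mod_cast hTeq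
    rw [hbud] at h
    linarith
  have hnonneg : ∀ x, 0 ≤ (u x - 4 * sZ (f x)) ^ 2 - ((if Odd (u x) then 1 else 0) + 4 * (if ¬ Odd (u x) ∧ Odd (u x / 2) then 1 else 0)
      + 16 * (if ¬ Odd (u x) ∧ ¬ Odd (u x / 2) ∧ ¬ Odd (u x / 2 / 2) then 1 else 0)
      + 8 * (if Odd (u x) ∧ (Odd (u x / 2) ↔ Odd (u x / 2 / 2)) then 1 else 0) : ℤ) :=
    fun x => by have := sb_pt2 (u x) (sZ (f x)) (tp_sZ_cases (f x)); linarith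
  have hsum0 : ∑ x, ((u x - 4 * sZ (f x)) ^ 2 - ((if Odd (u x) then 1 else 0) + 4 * (if ¬ Odd (u x) ∧ Odd (u x / 2) then 1 else 0)
      + 16 * (if ¬ Odd (u x) ∧ ¬ Odd (u x / 2) ∧ ¬ Odd (u x / 2 / 2) then 1 else 0)
      + 8 * (if Odd (u x) ∧ (Odd (u x / 2) ↔ Odd (u x / 2 / 2)) then 1 else 0) : ℤ)) = 0 := by
    refine le_antisymm ?_ (sum_nonneg fun x _ => hnonneg x)
    have hsplit : ∑ x, ((u x - 4 * sZ (f x)) ^ 2 - ((if Odd (u x) then 1 else 0)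
        + 4 * (if ¬ Odd (u x) ∧ Odd (u x / 2) then 1 else 0)
        + 16 * (if ¬ Odd (u x) ∧ ¬ Odd (u x / 2) ∧ ¬ Odd (u x / 2 / 2) then 1 else 0)
        + 8 * (if Odd (u x) ∧ (Odd (u x / 2) ↔ Odd (u x / 2 / 2)) then 1 else 0) : ℤ)) =
        (∑ x, (u x - 4 * sZ (f x)) ^ 2 : ℤ) - ((#O : ℤ) + 4 * #A + 16 * #B + 8 * #C) := by
      simp only [sum_sub_distrib, sum_add_distrib, ← mul_sum, sum_boole, hO, hA, hB, hC]
    rw [hsplit, hTeq]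
    linarith
  have hpt : ∀ x, (u x - 4 * sZ (f x)) ^ 2 = (if Odd (u x) then 1 else 0) + 4 * (if ¬ Odd (u x) ∧ Odd (u x / 2) then 1 else 0)
      + 16 * (if ¬ Odd (u x) ∧ ¬ Odd (u x / 2) ∧ ¬ Odd (u x / 2 / 2) then 1 else 0)
      + 8 * (if Odd (u x) ∧ (Odd (u x / 2) ↔ Odd (u x / 2 / 2)) then 1 else 0) := by
    intro x
    have := (sum_eq_zero_iff_of_nonneg fun y _ => hnonneg y).1 hsum0 x (mem_univ x)
    linarith
  refine ⟨hΦeq, hpt, ?_⟩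
  rcases hcases with ⟨h1, h2, h3⟩ | ⟨h1, h2, h3⟩ | ⟨h1, h2, h3⟩
  · left; exact ⟨by exact_mod_cast h1, by exact_mod_cast h2, by exact_mod_cast h3⟩
  · right; left; exact ⟨by exact_mod_cast h1, by exact_mod_cast h2, by exact_mod_cast h3⟩
  · right; right; exact ⟨by exact_mod_cast h1, by exact_mod_cast h2, by exact_mod_cast h3⟩

end Split

end Summit.QuantumAdvantage.QuantumAdvantage.Theorems.CubicForrelation.NearExactIsExact

end
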